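import Summits.CriticalPhenomena.PercolationContinuityZ3.Theorems.PercNearOneGluingNoHeavyLowerTailSahiE3UnionTensorLattice
import Summits.CriticalPhenomena.PercolationContinuityZ3.Theorems.SahiMasterFamilyIndependentConjunction
import HarnessLib

/-!
# `NoHeavyLowerTail` (crux stmt-CriticalPhenomena-4575), Sahi programme P4: Kahn's Conjecture 5 for UNION- and INTERSECTION-SEPARABLE
# triples over blocks of at most four coins (computational leaf: the kernel certificate `C₃` on `≤ 4` coins)

Support file (cell `prim-l12`, seat P4, generation 32; `--supports stmt-CriticalPhenomena-4575`, COMPUTATIONAL because the tree's `C₃` on four coins,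
`SahiHereditaryMeetAbsorption.sahiPositive_bernoulliWeight_three_of_card_le_four`, rests on the `native_decide` certificate `SahiC3Cube.checkCube_four`).
Companion of `…SahiE3UnionTensorLattice` (pure: the lattice-level OR and AND steps) and of `SahiTotalCumulance.sahiE_three_separable_nonneg_of_card_le_four`
(AND, both blocks `≤ 4`).

* `sahiE_three_unionSeparable_nonneg_of_card_le_four` — on `2^{ι₁ ⊔ ι₂}` with `|ι₁|, |ι₂| ≤ 4` and ANY product measure, every triple of events
  `{ω : ω|ι₁ ∈ A_i or ω|ι₂ ∈ B_i}` (`A_i`, `B_i` increasing) has `E₃ ≥ 0`.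
* `sahiE_three_unionSeparable_step`, `sahiE_three_interSeparable_step` — THE INDUCTIVE STEPS: for ANY finite `ι₁`, any product measure and increasing
  `A_i ⊆ 2^{ι₁}` with `E₃(1_{A_0},1_{A_1},1_{A_2}) ≥ 0`, OR-ing (resp. AND-ing) member-wise a further independent block of `≤ 4` coins keeps `E₃ ≥ 0`.
  Iterating: **Kahn's inequality `E₃ ≥ 0` holds for every triple built block by block over a partition of the coins into blocks of `≤ 4`, with at
  each block the same gate (all-OR or all-AND) for the three members** — e.g. `U_i = ((A_i¹ ∨ A_i²) ∧ A_i³) ∨ A_i⁴`, `A_i^j` increasing in block `j`.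
* `sahiE_three_unionSeparable_nonneg_three_blocks` — the step applied once more (three blocks, up to twelve coins), as a worked instance.
HONEST FRAMING: unconditional classes; nothing is asserted about `C₃` in general; mixed gates at one block (member 0 OR, member 1 AND) are not covered
(LP evidence only, seat memo gen 32). [this work]
-/

noncomputable section

namespace Summit.CriticalPhenomena.PercolationContinuityZ3.Theorems.SahiE3UnionTensor

open Finset Function Literature.Combinatorics.Sahi2008
open Literature.Probability.Percolation.DecisionTree (ind ind_of_mem ind_of_not_mem ind_nonneg)

/-! ### Cubes: unions of separable increasing events on `2^{ι₁ ⊔ ι₂}`, `|ι₁|, |ι₂| ≤ 4` -/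

section Cube

variable {ι₁ ι₂ : Type*} [Fintype ι₁] [Fintype ι₂]

omit [Fintype ι₁] [Fintype ι₂] in
/-- The indicator of a union-separable event `{ω | ω|ι₁ ∈ A ∨ ω|ι₂ ∈ B}` pulls back along `glue` to the probabilistic OR of the two
indicators. [this work] -/
theorem ind_unionSeparable_comp_glue (A : Set (Set ι₁)) (B : Set (Set ι₂)) :
    (ind {ω : Set (ι₁ ⊕ ι₂) | Sum.inl ⁻¹' ω ∈ A ∨ Sum.inr ⁻¹' ω ∈ B}) ∘ SahiTotalCumulance.glue =
      fun q : Set ι₁ × Set ι₂ => ind A q.1 + ind B q.2 - ind A q.1 * ind B q.2 := by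
  funext q
  simp only [Function.comp_apply, ind, Set.mem_setOf_eq, SahiTotalCumulance.preimage_inl_glue,
    SahiTotalCumulance.preimage_inr_glue]
  by_cases hA : q.1 ∈ A <;> by_cases hB : q.2 ∈ B <;> simp [hA, hB]

omit [Fintype ι₁] in
/-- An indicator is at most one. [folklore] -/
theorem ind_le_one' (A : Set (Set ι₁)) (x : Set ι₁) : ind A x ≤ 1 := by
  by_cases h : x ∈ A
  · rw [ind_of_mem h]
  · rw [ind_of_not_mem h]; exact zero_le_one

/-- **A new unconditional class for Kahn's Conjecture 5 / Sahi's `C₃` (unions)**: on `2^{ι₁ ⊔ ι₂}` with `|ι₁|, |ι₂| ≤ 4` and ANY product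
measure, every triple of union-separable events `{ω : ω|ι₁ ∈ A_i ∨ ω|ι₂ ∈ B_i}` (`A_i` increasing in the `ι₁`-coordinates, `B_i` increasing in the
`ι₂`-coordinates) has `E₃ ≥ 0`. [this work] -/
theorem sahiE_three_unionSeparable_nonneg_of_card_le_four (hι₁ : Fintype.card ι₁ ≤ 4) (hι₂ : Fintype.card ι₂ ≤ 4)
    (p₁ : ι₁ → unitInterval) (p₂ : ι₂ → unitInterval) (A : Fin 3 → Set (Set ι₁)) (B : Fin 3 → Set (Set ι₂))
    (hA : ∀ i, IsUpperSet (A i)) (hB : ∀ i, IsUpperSet (B i)) :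
    0 ≤ sahiE (bernoulliWeight (Sum.elim p₁ p₂)) 3
      (fun i => ind {ω : Set (ι₁ ⊕ ι₂) | Sum.inl ⁻¹' ω ∈ A i ∨ Sum.inr ⁻¹' ω ∈ B i}) := by
  rw [← SahiTotalCumulance.pushWeight_glue, sahiE_pushWeight]
  have hfam : (fun i => (ind {ω : Set (ι₁ ⊕ ι₂) | Sum.inl ⁻¹' ω ∈ A i ∨ Sum.inr ⁻¹' ω ∈ B i}) ∘ SahiTotalCumulance.glue) =
      fun (i : Fin 3) (q : Set ι₁ × Set ι₂) => ind (A i) q.1 + ind (B i) q.2 - ind (A i) q.1 * ind (B i) q.2 := by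
    funext i
    exact ind_unionSeparable_comp_glue (A i) (B i)
  rw [hfam]
  have h₁ := SahiTotalCumulance.sahiPositive_bernoulliWeight_le_three_of_card_le_four hι₁ p₁
  have h₂ := SahiTotalCumulance.sahiPositive_bernoulliWeight_le_three_of_card_le_four hι₂ p₂
  exact sahiE_three_por_nonneg_of_sahiPositive_two (bernoulliWeight p₁) (bernoulliWeight p₂)
    (isFKGMeasure_bernoulliWeight p₁).nonneg (sum_bernoulliWeight p₁) (isFKGMeasure_bernoulliWeight p₂).nonneg (sum_bernoulliWeight p₂)
    (h₁ 2 (by norm_num)) (h₂ 2 (by norm_num))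
    (fun i => ind (A i)) (fun i => ind (B i)) (fun i x => ind_nonneg _ _) (fun i x => ind_le_one' _ _)
    (fun i => SahiTotalCumulance.monotone_ind_of_isUpperSet (hA i))
    (fun i y => ind_nonneg _ _) (fun i y => ind_le_one' _ _) (fun i => SahiTotalCumulance.monotone_ind_of_isUpperSet (hB i))
    (h₁ 3 le_rfl _ (fun i x => ind_nonneg _ _) fun i => SahiTotalCumulance.monotone_ind_of_isUpperSet (hA i))
    (h₂ 3 le_rfl _ (fun i y => ind_nonneg _ _) fun i => SahiTotalCumulance.monotone_ind_of_isUpperSet (hB i))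

/-- **The inductive step on cubes: OR-ing one more independent block of at most four coins preserves `E₃ ≥ 0`.**  For ANY finite `ι₁`, any
product measure and increasing `A_0,A_1,A_2 ⊆ 2^{ι₁}` with `E₃(1_{A_0},1_{A_1},1_{A_2}) ≥ 0`, and a block `ι₂` of at most four further coins with
increasing `B_i ⊆ 2^{ι₂}`, the unions `{ω : ω|ι₁ ∈ A_i ∨ ω|ι₂ ∈ B_i}` have `E₃ ≥ 0` on `2^{ι₁ ⊔ ι₂}`.  Iterating block by block: Kahn's Conjecture 5
holds for every triple of events `⋃_j A_i^{(j)}` with each `A_i^{(j)}` increasing and determined by a block of `≤ 4` coins of a fixed partition of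
the coordinates (any number of blocks, any product measure). [this work] -/
theorem sahiE_three_unionSeparable_step (p₁ : ι₁ → unitInterval) (p₂ : ι₂ → unitInterval) (hι₂ : Fintype.card ι₂ ≤ 4)
    (A : Fin 3 → Set (Set ι₁)) (B : Fin 3 → Set (Set ι₂)) (hA : ∀ i, IsUpperSet (A i)) (hB : ∀ i, IsUpperSet (B i))
    (hE : 0 ≤ sahiE (bernoulliWeight p₁) 3 (fun i => ind (A i))) :
    0 ≤ sahiE (bernoulliWeight (Sum.elim p₁ p₂)) 3
      (fun i => ind {ω : Set (ι₁ ⊕ ι₂) | Sum.inl ⁻¹' ω ∈ A i ∨ Sum.inr ⁻¹' ω ∈ B i}) := by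
  rw [← SahiTotalCumulance.pushWeight_glue, sahiE_pushWeight]
  have hfam : (fun i => (ind {ω : Set (ι₁ ⊕ ι₂) | Sum.inl ⁻¹' ω ∈ A i ∨ Sum.inr ⁻¹' ω ∈ B i}) ∘ SahiTotalCumulance.glue) =
      fun (i : Fin 3) (q : Set ι₁ × Set ι₂) => ind (A i) q.1 + ind (B i) q.2 - ind (A i) q.1 * ind (B i) q.2 := by
    funext i
    exact ind_unionSeparable_comp_glue (A i) (B i)
  rw [hfam]
  have h₂ := SahiTotalCumulance.sahiPositive_bernoulliWeight_le_three_of_card_le_four hι₂ p₂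
  exact sahiE_three_por_nonneg_of_sahiPositive_two (bernoulliWeight p₁) (bernoulliWeight p₂)
    (isFKGMeasure_bernoulliWeight p₁).nonneg (sum_bernoulliWeight p₁) (isFKGMeasure_bernoulliWeight p₂).nonneg (sum_bernoulliWeight p₂)
    (sahiPositive_two (isFKGMeasure_bernoulliWeight p₁)) (h₂ 2 (by norm_num))
    (fun i => ind (A i)) (fun i => ind (B i)) (fun i x => ind_nonneg _ _) (fun i x => ind_le_one' _ _)
    (fun i => SahiTotalCumulance.monotone_ind_of_isUpperSet (hA i))
    (fun i y => ind_nonneg _ _) (fun i y => ind_le_one' _ _) (fun i => SahiTotalCumulance.monotone_ind_of_isUpperSet (hB i))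
    hE (h₂ 3 le_rfl _ (fun i y => ind_nonneg _ _) fun i => SahiTotalCumulance.monotone_ind_of_isUpperSet (hB i))

omit [Fintype ι₁] [Fintype ι₂] in
/-- A union-separable event built from increasing events is increasing. [this work] -/
theorem isUpperSet_unionSeparable {A : Set (Set ι₁)} {B : Set (Set ι₂)} (hA : IsUpperSet A) (hB : IsUpperSet B) :
    IsUpperSet {ω : Set (ι₁ ⊕ ι₂) | Sum.inl ⁻¹' ω ∈ A ∨ Sum.inr ⁻¹' ω ∈ B} := by
  intro ω ω' hle h
  rcases h with h | h
  · exact Or.inl (hA (Set.preimage_mono hle) h)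
  · exact Or.inr (hB (Set.preimage_mono hle) h)

/-- **Three blocks** (the inductive step applied once more): on `2^{(ι₁ ⊔ ι₂) ⊔ ι₃}` with `|ι₁|, |ι₂|, |ι₃| ≤ 4` and any product measure, every
triple of events "`ω|ι₁ ∈ A_i` or `ω|ι₂ ∈ B_i` or `ω|ι₃ ∈ C_i`" (`A_i, B_i, C_i` increasing) has `E₃ ≥ 0` — up to twelve coins in three blocks;
further blocks are added in the same way. [this work] -/
theorem sahiE_three_unionSeparable_nonneg_three_blocks {ι₃ : Type*} [Fintype ι₃]
    (hι₁ : Fintype.card ι₁ ≤ 4) (hι₂ : Fintype.card ι₂ ≤ 4) (hι₃ : Fintype.card ι₃ ≤ 4)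
    (p₁ : ι₁ → unitInterval) (p₂ : ι₂ → unitInterval) (p₃ : ι₃ → unitInterval)
    (A : Fin 3 → Set (Set ι₁)) (B : Fin 3 → Set (Set ι₂)) (C : Fin 3 → Set (Set ι₃))
    (hA : ∀ i, IsUpperSet (A i)) (hB : ∀ i, IsUpperSet (B i)) (hC : ∀ i, IsUpperSet (C i)) :
    0 ≤ sahiE (bernoulliWeight (Sum.elim (Sum.elim p₁ p₂) p₃)) 3
      (fun i => ind {ω : Set ((ι₁ ⊕ ι₂) ⊕ ι₃) |
        Sum.inl ⁻¹' ω ∈ {ω' : Set (ι₁ ⊕ ι₂) | Sum.inl ⁻¹' ω' ∈ A i ∨ Sum.inr ⁻¹' ω' ∈ B i} ∨ Sum.inr ⁻¹' ω ∈ C i}) :=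
  sahiE_three_unionSeparable_step (Sum.elim p₁ p₂) p₃ hι₃ (fun i => {ω' : Set (ι₁ ⊕ ι₂) | Sum.inl ⁻¹' ω' ∈ A i ∨ Sum.inr ⁻¹' ω' ∈ B i}) C
    (fun i => isUpperSet_unionSeparable (hA i) (hB i)) hC (sahiE_three_unionSeparable_nonneg_of_card_le_four hι₁ hι₂ p₁ p₂ A B hA hB)

end Cube

section CubeAnd

variable {ι₁ ι₂ : Type*} [Fintype ι₁] [Fintype ι₂]

/-- **The AND inductive step on cubes** (row-level version of `SahiTotalCumulance.sahiE_separable_nonneg` at order 3): for ANY finite `ι₁`, any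
product measure and increasing `A_i ⊆ 2^{ι₁}` with `E₃(1_{A_0},1_{A_1},1_{A_2}) ≥ 0`, and a block `ι₂` of at most four further coins with increasing
`B_i`, the separable events `{ω : ω|ι₁ ∈ A_i ∧ ω|ι₂ ∈ B_i}` have `E₃ ≥ 0`.  With `sahiE_three_unionSeparable_step`: every triple built block by block
with, at each block, the SAME gate (all-AND or all-OR) for the three members — blocks of `≤ 4` coins, any number, any product measure — satisfies
Kahn's inequality `E₃ ≥ 0`. [this work] -/
theorem sahiE_three_interSeparable_step (p₁ : ι₁ → unitInterval) (p₂ : ι₂ → unitInterval) (hι₂ : Fintype.card ι₂ ≤ 4)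
    (A : Fin 3 → Set (Set ι₁)) (B : Fin 3 → Set (Set ι₂)) (hA : ∀ i, IsUpperSet (A i)) (hB : ∀ i, IsUpperSet (B i))
    (hE : 0 ≤ sahiE (bernoulliWeight p₁) 3 (fun i => ind (A i))) :
    0 ≤ sahiE (bernoulliWeight (Sum.elim p₁ p₂)) 3
      (fun i => ind {ω : Set (ι₁ ⊕ ι₂) | Sum.inl ⁻¹' ω ∈ A i ∧ Sum.inr ⁻¹' ω ∈ B i}) := by
  rw [← SahiTotalCumulance.pushWeight_glue, sahiE_pushWeight]
  have hfam : (fun i => (ind {ω : Set (ι₁ ⊕ ι₂) | Sum.inl ⁻¹' ω ∈ A i ∧ Sum.inr ⁻¹' ω ∈ B i}) ∘ SahiTotalCumulance.glue) =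
      fun (i : Fin 3) (q : Set ι₁ × Set ι₂) => ind (A i) q.1 * ind (B i) q.2 := by
    funext i
    exact SahiTotalCumulance.ind_separable_comp_glue (A i) (B i)
  rw [hfam]
  have h₂ := SahiTotalCumulance.sahiPositive_bernoulliWeight_le_three_of_card_le_four hι₂ p₂
  exact sahiE_three_pand_nonneg_of_sahiPositive_two (bernoulliWeight p₁) (bernoulliWeight p₂)
    (isFKGMeasure_bernoulliWeight p₁).nonneg (isFKGMeasure_bernoulliWeight p₂).nonneg
    (sahiPositive_two (isFKGMeasure_bernoulliWeight p₁)) (h₂ 2 (by norm_num))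
    (fun i => ind (A i)) (fun i => ind (B i)) (fun i x => ind_nonneg _ _) (fun i => SahiTotalCumulance.monotone_ind_of_isUpperSet (hA i))
    (fun i y => ind_nonneg _ _) (fun i => SahiTotalCumulance.monotone_ind_of_isUpperSet (hB i))
    hE (h₂ 3 le_rfl _ (fun i y => ind_nonneg _ _) fun i => SahiTotalCumulance.monotone_ind_of_isUpperSet (hB i))


end CubeAnd

end Summit.CriticalPhenomena.PercolationContinuityZ3.Theorems.SahiE3UnionTensor

end
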